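import Mathlib

/-!
# Route LogTimeThreeAnnuli — bookkeeping behind `NearZoneSlaving`:
# a windowed slaving inequality yields the one-step dyadic renewal term

Support lemma (pure real analysis in `ℝ≥0∞`) for the informal support item
`stmt-FinalStateConjecture-13464` (`NearZoneSlaving`) of route `LogTimeThreeAnnuli` for the Final
State Conjecture. The item states near-zone slaving in WINDOWED form: for every window length
`L ≥ L₀` and every start time `T`, the near-zone size on the late window `[T + L, T + 2L]` is at
most `θ` times the near-zone size on the early window `[T, T + L]` plus a collar (forcing) term
for the window `[T, T + 2L]`. The route consumes it in DYADIC form (the `θ δₙ` term of the renewal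
inequality `δₙ₊₁ ≤ θ δₙ + Σⱼ Kₙ₋ⱼ δⱼ + gₙ` behind `DyadicSummability`, with
`δₙ = sup_{τ ∈ [2ⁿ, 2ⁿ⁺¹]} N τ`). One window `[T, T + L] → [T + L, T + 2L]` with `T = L = 2ⁿ` only
reaches `3 · 2ⁿ`; chaining a second window started at `2ⁿ⁺¹` covers `[2ⁿ⁺¹, 2ⁿ⁺²]`, at the price
of the constants `max θ θ²` (`= θ` when `θ ≤ 1`) and `(1 + θ)` in front of the forcing. The
slaving factor may depend on the window length, `Θ : ℝ → ℝ≥0∞` (the item prints the gain `C/L`;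
`θ = Θ(2ⁿ) = C/2ⁿ` is then even summable):

* `iSup_Icc_two_mul_le_of_windowed_slaving` — the two-window chaining on `[T, 2T] → [2T, 4T]`;
* `dyadic_renewal_step_of_windowed_slaving` — the same on `[2ⁿ, 2ⁿ⁺¹] → [2ⁿ⁺¹, 2ⁿ⁺²]`;
* `dyadic_renewal_step_of_windowed_slaving_of_le_one` — with `θ ≤ 1` the factor is `θ` itself;
* `exists_index_dyadic_renewal_of_windowed_slaving` — the same from some dyadic index `n₀` on, in
  the indexing `[2^{n₀+n}, 2^{n₀+n+1}]` of `DyadicSummability`.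

Sizes are `ℝ≥0∞`-valued functions of chart time (as `truncDeviationCk` in the route file) and the
forcing is any functional `G T T'` of the window `[T, T']` monotone under enlargement of the
window (a supremum or an integral of a nonnegative collar quantity over the window). No literature
facts are used.
-/

-- every `Summit.FinalStateConjecture.FinalStateConjecture.…` name repeats the summit = sub-problem
-- segment (D-0017 layout, CONVENTIONS §2); the duplicate is deliberate.
set_option linter.dupNamespace false

namespace Summit.FinalStateConjecture.FinalStateConjecture.Theorems

open Set
open scoped ENNReal

/-- **Two-window chaining.** If a size function `N : ℝ → ℝ≥0∞` obeys the windowed slaving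
inequality `sup_{[S+L, S+2L]} N ≤ Θ(L) · sup_{[S, S+L]} N + G S (S + 2L)` for all start times
`S ≥ T₀` and window lengths `L ≥ L₀` (slaving factor `Θ(L)` allowed to depend on the window
length, e.g. `Θ(L) = C/L` as in the item, or a constant `θ < 1`), with a forcing functional `G`
monotone under enlargement of the window, then for every `T ≥ max T₀ L₀`, `T ≥ 0`, writing
`θ = Θ(T)`: `sup_{[2T, 4T]} N ≤ max θ θ² · sup_{[T, 2T]} N + (1 + θ) · G T (4T)`
(apply the hypothesis on `[T, 2T] → [2T, 3T]` and on `[2T, 3T] → [3T, 4T]`, both of length `T`). -/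
theorem iSup_Icc_two_mul_le_of_windowed_slaving (N : ℝ → ℝ≥0∞) (G : ℝ → ℝ → ℝ≥0∞)
    (Θ : ℝ → ℝ≥0∞) (T₀ L₀ T : ℝ)
    (hG : ∀ S S' U U' : ℝ, U ≤ S → S' ≤ U' → G S S' ≤ G U U')
    (hslave : ∀ S L : ℝ, T₀ ≤ S → L₀ ≤ L →
      ⨆ τ ∈ Icc (S + L) (S + 2 * L), N τ ≤ Θ L * (⨆ τ ∈ Icc S (S + L), N τ) + G S (S + 2 * L))
    (hT₀ : T₀ ≤ T) (hL₀ : L₀ ≤ T) (hT : 0 ≤ T) :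
    ⨆ τ ∈ Icc (2 * T) (4 * T), N τ
      ≤ max (Θ T) (Θ T ^ 2) * (⨆ τ ∈ Icc T (2 * T), N τ) + (1 + Θ T) * G T (4 * T) := by
  set δ := ⨆ τ ∈ Icc T (2 * T), N τ with hδ
  set θ := Θ T with hθdef
  -- first window: `[T, 2T] → [2T, 3T]`
  have h1 : ⨆ τ ∈ Icc (2 * T) (3 * T), N τ ≤ θ * δ + G T (4 * T) := by
    have h := hslave T T hT₀ hL₀
    have e1 : T + T = 2 * T := by ring
    have e2 : T + 2 * T = 3 * T := by ring
    rw [e1, e2] at h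
    calc ⨆ τ ∈ Icc (2 * T) (3 * T), N τ ≤ θ * δ + G T (3 * T) := h
      _ ≤ θ * δ + G T (4 * T) :=
        add_le_add le_rfl (hG T (3 * T) T (4 * T) le_rfl (by linarith))
  -- second window: `[2T, 3T] → [3T, 4T]`
  have h2 : ⨆ τ ∈ Icc (3 * T) (4 * T), N τ ≤ θ ^ 2 * δ + (1 + θ) * G T (4 * T) := by
    have h := hslave (2 * T) T (by linarith) hL₀
    have e1 : 2 * T + T = 3 * T := by ring
    have e2 : 2 * T + 2 * T = 4 * T := by ring
    rw [e1, e2] at h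
    calc ⨆ τ ∈ Icc (3 * T) (4 * T), N τ
        ≤ θ * (⨆ τ ∈ Icc (2 * T) (3 * T), N τ) + G (2 * T) (4 * T) := h
      _ ≤ θ * (θ * δ + G T (4 * T)) + G T (4 * T) :=
        add_le_add (mul_le_mul' le_rfl h1) (hG (2 * T) (4 * T) T (4 * T) (by linarith) le_rfl)
      _ = θ ^ 2 * δ + (1 + θ) * G T (4 * T) := by ring
  -- union of the two late windows
  have hunion : Icc (2 * T) (4 * T) = Icc (2 * T) (3 * T) ∪ Icc (3 * T) (4 * T) :=
    (Icc_union_Icc_eq_Icc (by linarith) (by linarith)).symm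
  rw [hunion, iSup_union]
  refine sup_le ?_ ?_
  · calc ⨆ τ ∈ Icc (2 * T) (3 * T), N τ ≤ θ * δ + G T (4 * T) := h1
      _ ≤ max θ (θ ^ 2) * δ + (1 + θ) * G T (4 * T) := by
        refine add_le_add (mul_le_mul' (le_max_left _ _) le_rfl) ?_
        calc G T (4 * T) = 1 * G T (4 * T) := (one_mul _).symm
          _ ≤ (1 + θ) * G T (4 * T) := mul_le_mul' le_self_add le_rfl
  · calc ⨆ τ ∈ Icc (3 * T) (4 * T), N τ ≤ θ ^ 2 * δ + (1 + θ) * G T (4 * T) := h2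
      _ ≤ max θ (θ ^ 2) * δ + (1 + θ) * G T (4 * T) :=
        add_le_add (mul_le_mul' (le_max_right _ _) le_rfl) le_rfl

/-- **Dyadic renewal step from windowed slaving.** Under the windowed slaving hypothesis of
`iSup_Icc_two_mul_le_of_windowed_slaving`, for every dyadic index `n` with `2ⁿ ≥ max T₀ L₀` the
dyadic suprema `δₙ = sup_{τ ∈ [2ⁿ, 2ⁿ⁺¹]} N τ` satisfy the one-step renewal inequality
`δₙ₊₁ ≤ max θₙ θₙ² · δₙ + (1 + θₙ) · G 2ⁿ 2ⁿ⁺²`, `θₙ = Θ(2ⁿ)` — the `θ δₙ` term of the renewal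
scheme of route `LogTimeThreeAnnuli` (`DyadicSummability`, `DiscreteRenewal`). -/
theorem dyadic_renewal_step_of_windowed_slaving (N : ℝ → ℝ≥0∞) (G : ℝ → ℝ → ℝ≥0∞)
    (Θ : ℝ → ℝ≥0∞) (T₀ L₀ : ℝ) (n : ℕ)
    (hG : ∀ S S' U U' : ℝ, U ≤ S → S' ≤ U' → G S S' ≤ G U U')
    (hslave : ∀ S L : ℝ, T₀ ≤ S → L₀ ≤ L →
      ⨆ τ ∈ Icc (S + L) (S + 2 * L), N τ ≤ Θ L * (⨆ τ ∈ Icc S (S + L), N τ) + G S (S + 2 * L))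
    (hT₀ : T₀ ≤ (2 : ℝ) ^ n) (hL₀ : L₀ ≤ (2 : ℝ) ^ n) :
    ⨆ τ ∈ Icc ((2 : ℝ) ^ (n + 1)) ((2 : ℝ) ^ (n + 2)), N τ
      ≤ max (Θ (2 ^ n)) (Θ (2 ^ n) ^ 2) * (⨆ τ ∈ Icc ((2 : ℝ) ^ n) ((2 : ℝ) ^ (n + 1)), N τ)
        + (1 + Θ (2 ^ n)) * G ((2 : ℝ) ^ n) ((2 : ℝ) ^ (n + 2)) := by
  have h := iSup_Icc_two_mul_le_of_windowed_slaving N G Θ T₀ L₀ ((2 : ℝ) ^ n) hG hslave hT₀ hL₀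
    (by positivity)
  have e1 : (2 : ℝ) * 2 ^ n = 2 ^ (n + 1) := by ring
  have e2 : (4 : ℝ) * 2 ^ n = 2 ^ (n + 2) := by ring
  rw [e1, e2] at h
  exact h

/-- **Dyadic renewal step, contraction factor `≤ 1`.** When the slaving factor satisfies
`θₙ = Θ(2ⁿ) ≤ 1` (the only case of interest: `θ < 1` is the near-zone contraction), `max θₙ θₙ² = θₙ`
and the dyadic step reads `δₙ₊₁ ≤ θₙ · δₙ + (1 + θₙ) · G 2ⁿ 2ⁿ⁺²`. -/
theorem dyadic_renewal_step_of_windowed_slaving_of_le_one (N : ℝ → ℝ≥0∞) (G : ℝ → ℝ → ℝ≥0∞)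
    (Θ : ℝ → ℝ≥0∞) (T₀ L₀ : ℝ) (n : ℕ) (hΘ : Θ (2 ^ n) ≤ 1)
    (hG : ∀ S S' U U' : ℝ, U ≤ S → S' ≤ U' → G S S' ≤ G U U')
    (hslave : ∀ S L : ℝ, T₀ ≤ S → L₀ ≤ L →
      ⨆ τ ∈ Icc (S + L) (S + 2 * L), N τ ≤ Θ L * (⨆ τ ∈ Icc S (S + L), N τ) + G S (S + 2 * L))
    (hT₀ : T₀ ≤ (2 : ℝ) ^ n) (hL₀ : L₀ ≤ (2 : ℝ) ^ n) :
    ⨆ τ ∈ Icc ((2 : ℝ) ^ (n + 1)) ((2 : ℝ) ^ (n + 2)), N τ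
      ≤ Θ (2 ^ n) * (⨆ τ ∈ Icc ((2 : ℝ) ^ n) ((2 : ℝ) ^ (n + 1)), N τ)
        + (1 + Θ (2 ^ n)) * G ((2 : ℝ) ^ n) ((2 : ℝ) ^ (n + 2)) := by
  have hmax : max (Θ (2 ^ n)) (Θ (2 ^ n) ^ 2) = Θ (2 ^ n) := by
    refine max_eq_left ?_
    calc Θ (2 ^ n) ^ 2 = Θ (2 ^ n) * Θ (2 ^ n) := sq _
      _ ≤ Θ (2 ^ n) * 1 := mul_le_mul' le_rfl hΘ
      _ = Θ (2 ^ n) := mul_one _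
  have h := dyadic_renewal_step_of_windowed_slaving N G Θ T₀ L₀ n hG hslave hT₀ hL₀
  rw [hmax] at h
  exact h

/-- **Dyadic renewal from some index on.** Under the windowed slaving hypothesis with
`Θ(L) ≤ 1` for `L ≥ L₀` there is a dyadic index `n₀` (any `n₀` with `2^{n₀} > max T₀ L₀`) from
which on every dyadic step contracts: for all `n`, with `θ = Θ(2^{n₀+n})`,
`sup_{[2^{n₀+n+1}, 2^{n₀+n+2}]} N ≤ θ · sup_{[2^{n₀+n}, 2^{n₀+n+1}]} N + (1 + θ) · G 2^{n₀+n} 2^{n₀+n+2}`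
— the indexing of `DyadicSummability` in the route file (windows `[2^{n₀+n}, 2^{n₀+n+1}]`). -/
theorem exists_index_dyadic_renewal_of_windowed_slaving (N : ℝ → ℝ≥0∞) (G : ℝ → ℝ → ℝ≥0∞)
    (Θ : ℝ → ℝ≥0∞) (T₀ L₀ : ℝ) (hΘ : ∀ L : ℝ, L₀ ≤ L → Θ L ≤ 1)
    (hG : ∀ S S' U U' : ℝ, U ≤ S → S' ≤ U' → G S S' ≤ G U U')
    (hslave : ∀ S L : ℝ, T₀ ≤ S → L₀ ≤ L →
      ⨆ τ ∈ Icc (S + L) (S + 2 * L), N τ ≤ Θ L * (⨆ τ ∈ Icc S (S + L), N τ) + G S (S + 2 * L)) :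
    ∃ n₀ : ℕ, ∀ n : ℕ,
      ⨆ τ ∈ Icc ((2 : ℝ) ^ (n₀ + n + 1)) ((2 : ℝ) ^ (n₀ + n + 2)), N τ
        ≤ Θ (2 ^ (n₀ + n)) * (⨆ τ ∈ Icc ((2 : ℝ) ^ (n₀ + n)) ((2 : ℝ) ^ (n₀ + n + 1)), N τ)
          + (1 + Θ (2 ^ (n₀ + n))) * G ((2 : ℝ) ^ (n₀ + n)) ((2 : ℝ) ^ (n₀ + n + 2)) := by
  obtain ⟨n₀, hn₀⟩ := pow_unbounded_of_one_lt (max T₀ L₀) (one_lt_two : (1 : ℝ) < 2)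
  refine ⟨n₀, fun n => ?_⟩
  have hmono : (2 : ℝ) ^ n₀ ≤ 2 ^ (n₀ + n) :=
    pow_le_pow_right₀ (by norm_num : (1 : ℝ) ≤ 2) (Nat.le_add_right n₀ n)
  have hT₀ : T₀ ≤ (2 : ℝ) ^ (n₀ + n) := ((le_max_left T₀ L₀).trans hn₀.le).trans hmono
  have hL₀ : L₀ ≤ (2 : ℝ) ^ (n₀ + n) := ((le_max_right T₀ L₀).trans hn₀.le).trans hmono
  exact dyadic_renewal_step_of_windowed_slaving_of_le_one N G Θ T₀ L₀ (n₀ + n) (hΘ _ hL₀) hG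
    hslave hT₀ hL₀

end Summit.FinalStateConjecture.FinalStateConjecture.Theorems
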